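import Mathlib

/-!
# SoloBlind kernel #103 — the corner singulant of the calibration profile is `π/2`

Solo-blind programme `AnomalousDissipation`, steady door, paper §24.53 (s55).
The analytic crux (H4-G₃) of the steady door says that the two-scale hierarchy of the designed
steady family is Gevrey of index `1/3` in `ε = n^{-1/9}` (Gevrey-1 in the tunnelling parameter
`ħ = √ε_n ∝ ε³`).  §24.53 measures this on the Painlevé-II corner normal form
`ħ² α'' = (α² - W(ξ)) α` with a curved pinning profile `W`: the exact-order inner hierarchy
`y = Σ_k ρ^{2k} y_k` (`ξ = ρ² s`, `α = ρ y`, `ħ = ρ³`) has local growth exponent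
`σ = d log|y_k/y_{k-1}| / d log k → 2/3` (index `1/3` in `ρ`), and its late terms are governed by
the SINGULANT `S* = ∫_{contact}^{z₁} √(2 W(t)) dt` to the nearest OTHER zero `z₁` of `W` along the
analytically continued LIVE branch `α² = W` (linearisation `2W`).  For the calibration profile
`W(t) = t + t²/2` the other zero is `z₁ = -2`, on `[-2, 0]` one has `2|W(t)| = -2t - t² = 1 - (t+1)²`,
and the singulant is the area of a unit half-disc:
`|S*| = ∫_{-2}^{0} √(-2t - t²) dt = π/2 = 1.5708`, against the measured Borel distance
`A = 1.568 ± 0.006` (work/layers/corner_gevrey.py, K = 44–60 orders) — and NOT the dead-side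
tunnelling action `∫_{-2}^{0} √|W| = π/(4√2) = 1.111` nor its double.  This file certifies the
reference value; the numerics are recorded in HOME/work/layers/run_K*.out and CLAIMS SB-C589.
-/

namespace Summit.AnomalousDissipation.AnomalousDissipation.Theorems

/-- Completing the square on the dead interval of the calibration profile `W(t) = t + t²/2`:
the live linearisation `2|W(t)| = -2t - t²` equals `1 - (t+1)²`. -/
theorem corner_live_linearisation_sq (t : ℝ) : -2 * t - t ^ 2 = 1 - (t + 1) ^ 2 := by
  ring

/-- On the dead interval `[-2, 0]` the profile `W(t) = t + t²/2` is nonpositive, so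
`2|W(t)| = -(2 W(t)) = -2t - t²` there. -/
theorem corner_profile_nonpos {t : ℝ} (h1 : -2 ≤ t) (h2 : t ≤ 0) : t + t ^ 2 / 2 ≤ 0 := by
  nlinarith

/-- **The corner singulant of the calibration profile.**  For `W(t) = t + t²/2`,
`∫_{-2}^{0} √(2|W(t)|) dt = ∫_{-2}^{0} √(-2t - t²) dt = π/2` (area of the unit half-disc after
`u = t + 1`).  This is the Borel distance measured in §24.53(2)(b) (`1.568 ± 0.006`). -/
theorem corner_singulant_semicircle :
    ∫ t in (-2 : ℝ)..0, Real.sqrt (-2 * t - t ^ 2) = Real.pi / 2 := by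
  have key := intervalIntegral.integral_comp_add_right (a := (-2 : ℝ)) (b := 0)
    (fun u : ℝ => Real.sqrt (1 - u ^ 2)) (1 : ℝ)
  have h1 : (-2 : ℝ) + 1 = -1 := by norm_num
  have h2 : (0 : ℝ) + 1 = 1 := by norm_num
  rw [h1, h2, integral_sqrt_one_sub_sq] at key
  rw [← key]
  apply intervalIntegral.integral_congr
  intro t _
  simp only
  congr 1
  ring

/-- The dead-side tunnelling action of the same profile is smaller by `√2`:
`∫_{-2}^{0} √|W(t)| dt = ∫_{-2}^{0} √((-2t - t²)/2) dt = (π/2)/√2 = π/(2√2)` — recorded to make the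
distinction of §24.53(2)(b) checkable (`1.111` vs the measured `1.568`). -/
theorem corner_dead_action :
    ∫ t in (-2 : ℝ)..0, Real.sqrt ((-2 * t - t ^ 2) / 2) = Real.pi / 2 / Real.sqrt 2 := by
  have hs : ∀ t : ℝ, Real.sqrt ((-2 * t - t ^ 2) / 2) = Real.sqrt (-2 * t - t ^ 2) / Real.sqrt 2 := by
    intro t
    rw [Real.sqrt_div' _ (by norm_num : (0:ℝ) ≤ 2)]
  simp_rw [hs, intervalIntegral.integral_div, corner_singulant_semicircle]

end Summit.AnomalousDissipation.AnomalousDissipation.Theorems
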